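import Summits.AtomisticToContinuum.Crystallization.Theorems.FreeSplittingCertificatesStrictSplittingRuleP1FluxFormQuad

/-!
# `StrictSplittingRule` (stmt-AtomisticToContinuum-12560): FLUX IDENTIFICATION RE-BASED AT ANY POINT — the boundary term of the far theorem for the translated far-ledger field `x ↦ v(y₀ + x)` is a cellwise form with re-centred coefficient integrals (P1 interpolant object, part 46)

Route `FreeSplittingCertificates`, crux r3 `StrictSplittingRule` (H12⋆ = `stub_coreJointCoercive`), unit b2b-freesplit-B gen 32.
VALUE = glue item **G1** of the kernel assembly map (HOME FAR-LEMMA-SPEC §23 (b), term (T4)): `integral_flux_p1Disp_eq_tsum` (gen 29) identifies the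
flux term `∫2χ⟪∇χ,Φ(v)⟫` of the far theorem only for the field centred at the ORIGIN; the two-site reduction needs the ledger of the odd representative
`p = (1,0,0)` too, whose far inequality (`farPencil4_weighted_integral_le_p1Disp_translate`, `y₀ = y_p`) carries the flux of the RE-BASED field
`ṽ(x) = v(y₀ + x)`.  Here, for ANY `y₀`:
* `p1FluxA₀/B₀/C₀`, `p1FluxCellForm₀` — the cell coefficient integrals and the cell form with the profiles re-centred at `y₀`
  (`A_T = ∫_T g₃(y−y₀)λ_{m₁}λ_{m₂}`, `B_T = ∫_T g₄(y−y₀)λλ(y−y₀)_j(y−y₀)_l`, `C_T = ∫_T g₃(y−y₀)λ_m(y−y₀)_j`; at `y₀ = 0` they are the forms of part 41/gen 29);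
* `integrable_flux_of_lipschitz` — the interface integrand is integrable for ANY continuous Lipschitz field (gen 29's proof, generic);
* `lipschitzWith_translate` (with part 15's `fpGrad_comp_add_left`: `∇ṽ(x) = ∇v(y₀+x)`);
* **`integral_flux_p1Disp_translate_eq_tsum`**: `∫ 2χ(x)⟪∇χ(x), Φ(ṽ)(x)⟫dx = Σ'_T p1FluxCellForm₀(y₀)(T)(W_T, G_T − A)` (translation invariance of Lebesgue
  measure + the cellwise computation of gen 29 with shifted profiles), instance **`integral_fluxF2_p1Disp_translate_eq_tsum`**, and the vertex-value form
  **`integral_flux_p1Disp_translate_eq_tsum_quad`** (`p1FluxQuad₀`) — the 12×12 forms the certificate tier encloses for parity B (CERT §30 (1)).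
NOT a proof of H12⋆, NOT summit progress.  [folklore: P1 finite elements]
-/

noncomputable section

open Set Function Metric MeasureTheory Filter Topology
open scoped BigOperators NNReal ENNReal

namespace Summit.AtomisticToContinuum.Crystallization.Theorems.StrictSplittingRuleBirth

open Literature.MathematicalPhysics.StatisticalMechanics
open Summit.AtomisticToContinuum.Crystallization.Theorems.PalmUnimodularRigidity.LayeredLawsSelectHcp

/-! ## Re-centred cell coefficient integrals and cell form -/

/-- Re-centred cell coefficient integral `A_T(m₁,m₂) = ∫_T g₃(y − y₀) λ_{m₁} λ_{m₂}`. -/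
def p1FluxA₀ (S1 S2 a h : ℝ) (y₀ : Fin 3 → ℝ) (i : (ℤ × ℤ × ℤ) × Fin 6) (m₁ m₂ : Fin 4) : ℝ :=
  ∫ y in p1RealCell a h i, fpFluxProfile S1 S2 3 (y - y₀) * (p1Lam a h i m₁ y * p1Lam a h i m₂ y)

/-- Re-centred cell coefficient integral `B_T(m₁,m₂,j,l) = ∫_T g₄(y − y₀) λ_{m₁} λ_{m₂} (y−y₀)_j (y−y₀)_l`. -/
def p1FluxB₀ (S1 S2 a h : ℝ) (y₀ : Fin 3 → ℝ) (i : (ℤ × ℤ × ℤ) × Fin 6) (m₁ m₂ : Fin 4) (j l : Fin 3) : ℝ :=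
  ∫ y in p1RealCell a h i, fpFluxProfile S1 S2 4 (y - y₀) * (p1Lam a h i m₁ y * p1Lam a h i m₂ y * ((y - y₀) j * (y - y₀) l))

/-- Re-centred cell coefficient integral `C_T(m,j) = ∫_T g₃(y − y₀) λ_m (y−y₀)_j`. -/
def p1FluxC₀ (S1 S2 a h : ℝ) (y₀ : Fin 3 → ℝ) (i : (ℤ × ℤ × ℤ) × Fin 6) (m : Fin 4) (j : Fin 3) : ℝ :=
  ∫ y in p1RealCell a h i, fpFluxProfile S1 S2 3 (y - y₀) * (p1Lam a h i m y * (y - y₀) j)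

/-- **The re-centred cell flux form** in the four vertex values `W` and the element gradient `G`. -/
def p1FluxCellForm₀ (S1 S2 ca cb cc cn a h : ℝ) (y₀ : Fin 3 → ℝ) (i : (ℤ × ℤ × ℤ) × Fin 6) (W : Fin 4 → Fin 3 → ℝ)
    (G : Fin 3 → Fin 3 → ℝ) : ℝ :=
  (∑ m₁ : Fin 4, ∑ m₂ : Fin 4, (ca * ∑ k : Fin 3, W m₁ k * W m₂ k) * p1FluxA₀ S1 S2 a h y₀ i m₁ m₂) +
    (∑ m₁ : Fin 4, ∑ m₂ : Fin 4, ∑ j : Fin 3, ∑ l : Fin 3, ((cb + cc) * (W m₁ j * W m₂ l)) * p1FluxB₀ S1 S2 a h y₀ i m₁ m₂ j l) +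
      ∑ m : Fin 4, ∑ j : Fin 3, (cn * ((∑ k : Fin 3, W m k * G k j) - fpTr G * W m j)) * p1FluxC₀ S1 S2 a h y₀ i m j

/-- At `y₀ = 0` the re-centred form is the form of gen 29. -/
theorem p1FluxCellForm₀_zero (S1 S2 ca cb cc cn a h : ℝ) (i : (ℤ × ℤ × ℤ) × Fin 6) (W : Fin 4 → Fin 3 → ℝ) (G : Fin 3 → Fin 3 → ℝ) :
    p1FluxCellForm₀ S1 S2 ca cb cc cn a h 0 i W G = p1FluxCellForm S1 S2 ca cb cc cn a h i W G := by
  simp only [p1FluxCellForm₀, p1FluxCellForm, p1FluxA₀, p1FluxB₀, p1FluxC₀, p1FluxA, p1FluxB, p1FluxC, sub_zero]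

/-! ## Translation: gradient, Lipschitz, integrability of the interface integrand -/

/-- The translate of a Lipschitz field is Lipschitz with the same constant. -/
theorem lipschitzWith_translate {v : (Fin 3 → ℝ) → (Fin 3 → ℝ)} {K : ℝ≥0} (hK : LipschitzWith K v) (y₀ : Fin 3 → ℝ) :
    LipschitzWith K (fun y => v (y₀ + y)) :=
  LipschitzWith.of_dist_le_mul fun x x' => by
    have := hK.dist_le_mul (y₀ + x) (y₀ + x')
    rwa [dist_add_left] at this

/-- **The interface integrand is integrable for any continuous Lipschitz field** (compact collar × linear growth; gen 29's argument, generic). -/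
theorem integrable_flux_of_lipschitz {S1 S2 : ℝ} (hS1 : 0 < S1) (hS12 : S1 < S2) (ca cb cc cn : ℝ)
    {v : (Fin 3 → ℝ) → (Fin 3 → ℝ)} {K : ℝ≥0} (hK : LipschitzWith K v) (hv : Continuous v) :
    Integrable fun x => 2 * fpChi S1 S2 x * fpFlux4DotGrad ca cb cc cn v (fpChi S1 S2) x := by
  have hχ : ContDiff ℝ 2 (fpChi S1 S2) := contDiff_two_fpChi S1 S2
  have hχ0 : (0 : Fin 3 → ℝ) ∉ tsupport (fpChi S1 S2) := zero_notMem_tsupport_fpChi hS1 hS12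
  have hS2 : (0 : ℝ) ≤ Real.sqrt S2 := Real.sqrt_nonneg _
  have hχ1 : ∀ y : Fin 3 → ℝ, Real.sqrt S2 ≤ ‖y‖ → fpChi S1 S2 y = 1 :=
    fun y hy => fpChi_eq_one_of_norm_ge hS12 hS2 (by rw [Real.sq_sqrt (hS1.trans hS12).le]) y hy
  set V : ℝ := ‖v 0‖ with hV
  have hK0 : (0 : ℝ) ≤ K := K.2
  have hV0 : 0 ≤ V := norm_nonneg _
  have hGn : ∀ x i j, |fpGrad v x i j| ≤ K := fun x i j => abs_fpGrad_le_of_lipschitz hK x i j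
  have hwn : ∀ x, ‖v x‖ ≤ V + K * ‖x‖ := fun x => norm_le_of_lipschitz hK x
  refine Integrable.mono' (integrable_fluxBound hχ hχ0 hχ1 (6 * |cn|) (3 * |ca| + 3 * |cb| + 9 * |cc|) K V)
    (measurable_two_chi_flux4DotGrad ca cb cc cn hv hχ).aestronglyMeasurable
    (ae_of_all _ fun x => ?_)
  have hB : ∀ j, |fpFlux4 ca cb cc cn v x j| ≤
      (3 * |ca| + 3 * |cb| + 9 * |cc|) * (fpSq x)⁻¹ ^ 4 * ‖x‖ * (V + K * ‖x‖) ^ 2 + 6 * |cn| * K * (fpSq x)⁻¹ ^ 3 * (V + K * ‖x‖) :=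
    fun j => abs_fpFlux4_le ca cb cc cn hK0 (by nlinarith [norm_nonneg x]) (hGn x) (hwn x) j
  set B := (3 * |ca| + 3 * |cb| + 9 * |cc|) * (fpSq x)⁻¹ ^ 4 * ‖x‖ * (V + K * ‖x‖) ^ 2 +
      6 * |cn| * K * (fpSq x)⁻¹ ^ 3 * (V + K * ‖x‖) with hBdef
  set χ := fpChi S1 S2 with hχdef
  rw [Real.norm_eq_abs]
  unfold fpFlux4DotGrad
  have e : ∀ j, |2 * χ x * (fpGradS χ x j * fpFlux4 ca cb cc cn v x j)| ≤ |2 * χ x * fpGradS χ x j| * B :=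
    fun j => by
      rw [← mul_assoc, abs_mul]
      exact mul_le_mul_of_nonneg_left (hB j) (abs_nonneg _)
  calc |2 * χ x * (fpGradS χ x 0 * fpFlux4 ca cb cc cn v x 0 +
          fpGradS χ x 1 * fpFlux4 ca cb cc cn v x 1 + fpGradS χ x 2 * fpFlux4 ca cb cc cn v x 2)|
      = |2 * χ x * (fpGradS χ x 0 * fpFlux4 ca cb cc cn v x 0) +
          2 * χ x * (fpGradS χ x 1 * fpFlux4 ca cb cc cn v x 1) +
          2 * χ x * (fpGradS χ x 2 * fpFlux4 ca cb cc cn v x 2)| := by ring_nf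
    _ ≤ |2 * χ x * (fpGradS χ x 0 * fpFlux4 ca cb cc cn v x 0)| +
          |2 * χ x * (fpGradS χ x 1 * fpFlux4 ca cb cc cn v x 1)| +
          |2 * χ x * (fpGradS χ x 2 * fpFlux4 ca cb cc cn v x 2)| := abs_add_three _ _ _
    _ ≤ |2 * χ x * fpGradS χ x 0| * B + |2 * χ x * fpGradS χ x 1| * B + |2 * χ x * fpGradS χ x 2| * B := by
          linarith [e 0, e 1, e 2]
    _ = (|2 * χ x * fpGradS χ x 0| + |2 * χ x * fpGradS χ x 1| + |2 * χ x * fpGradS χ x 2|) * B := by ring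

/-! ## The flux integral over one cell, re-centred -/

section cell
variable {a h S1 S2 : ℝ} (ha : 0 < a) (hh : 0 < h) (hS1 : 0 < S1) (hS12 : S1 < S2) (y₀ : Fin 3 → ℝ) (i : (ℤ × ℤ × ℤ) × Fin 6)
include ha hh hS1 hS12

/-- The translated `A`-integrands `g₃(·−y₀)λλ` are integrable on the cell. -/
theorem integrableOn_fluxA₀ (m₁ m₂ : Fin 4) :
    IntegrableOn (fun y => fpFluxProfile S1 S2 3 (y - y₀) * (p1Lam a h i m₁ y * p1Lam a h i m₂ y)) (p1RealCell a h i) :=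
  integrableOn_p1RealCell_of_bounded ha.ne' hh.ne' i ((measurable_fpFluxProfile S1 S2 3).comp (measurable_id.sub_const y₀))
    (fun y => abs_fpFluxProfile_le hS1 hS12 3 (y - y₀)) ((continuous_p1Lam a h i m₁).mul (continuous_p1Lam a h i m₂))

/-- The translated `B`-integrands are integrable on the cell. -/
theorem integrableOn_fluxB₀ (m₁ m₂ : Fin 4) (j l : Fin 3) :
    IntegrableOn (fun y => fpFluxProfile S1 S2 4 (y - y₀) * (p1Lam a h i m₁ y * p1Lam a h i m₂ y * ((y - y₀) j * (y - y₀) l))) (p1RealCell a h i) :=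
  integrableOn_p1RealCell_of_bounded ha.ne' hh.ne' i ((measurable_fpFluxProfile S1 S2 4).comp (measurable_id.sub_const y₀))
    (fun y => abs_fpFluxProfile_le hS1 hS12 4 (y - y₀))
    (((continuous_p1Lam a h i m₁).mul (continuous_p1Lam a h i m₂)).mul
      (((continuous_apply j).comp (continuous_id.sub continuous_const)).mul ((continuous_apply l).comp (continuous_id.sub continuous_const))))

/-- The translated `C`-integrands are integrable on the cell. -/
theorem integrableOn_fluxC₀ (m : Fin 4) (j : Fin 3) :
    IntegrableOn (fun y => fpFluxProfile S1 S2 3 (y - y₀) * (p1Lam a h i m y * (y - y₀) j)) (p1RealCell a h i) :=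
  integrableOn_p1RealCell_of_bounded ha.ne' hh.ne' i ((measurable_fpFluxProfile S1 S2 3).comp (measurable_id.sub_const y₀))
    (fun y => abs_fpFluxProfile_le hS1 hS12 3 (y - y₀))
    ((continuous_p1Lam a h i m).mul ((continuous_apply j).comp (continuous_id.sub continuous_const)))

/-- **On one cell the translated interface density of the far-ledger field integrates to the translated cell flux form** of its vertex
values and element gradient. -/
theorem setIntegral_fluxTranslate_p1RealCell (ca cb cc cn : ℝ) (U : ℤ × ℤ × ℤ → (Fin 3 → ℝ)) (b₀ : Fin 3 → ℝ)
    (A : Fin 3 → Fin 3 → ℝ) :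
    ∫ y in p1RealCell a h i, fpFluxPre S1 S2 (y - y₀) *
        fpFluxDensity ca cb cc cn (y - y₀) (p1Disp a h U b₀ A y) (fpGrad (p1Disp a h U b₀ A) y) =
      p1FluxCellForm₀ S1 S2 ca cb cc cn a h y₀ i (p1CellVals (fun n k => p1DispSite a h U b₀ A n k) i)
        (fun j k => p1CellGrad a h U i j k - A j k) := by
  have ha' := ha.ne'
  have hh' := hh.ne'
  have hmeas := (isClosed_p1RealCell a h i).measurableSet
  -- (1) a.e. on the cell: gradient = G, value = Σ_m λ_m W_m
  have hvq : ∀ y ∈ p1RealCell a h i, p1Disp a h U b₀ A y =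
      fun k => ∑ m : Fin 4, p1Lam a h i m y * p1CellVals (fun n k => p1DispSite a h U b₀ A n k) i m k := by
    intro y hy
    rw [p1Disp_eq_p1Field ha' hh' U b₀ A, p1Field_eq_sum_p1Lam _ hy]
  have h1 : ∫ y in p1RealCell a h i, fpFluxPre S1 S2 (y - y₀) *
        fpFluxDensity ca cb cc cn (y - y₀) (p1Disp a h U b₀ A y) (fpGrad (p1Disp a h U b₀ A) y) =
      ∫ y in p1RealCell a h i, fpFluxPre S1 S2 (y - y₀) * fpFluxDensity ca cb cc cn (y - y₀)
        (fun k => ∑ m : Fin 4, p1Lam a h i m y * p1CellVals (fun n k => p1DispSite a h U b₀ A n k) i m k)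
        (fun j k => p1CellGrad a h U i j k - A j k) := by
    refine setIntegral_congr_ae hmeas ((fpGrad_p1Disp_ae ha' hh' U b₀ A i).mono fun y hy hmem => ?_)
    rw [hy hmem, hvq y hmem]
  rw [h1]
  simp only [fpFluxPre_mul_density_barycentric]
  -- (2) linearity: split the three sums and pull the constants
  have hIA : ∀ m₁ m₂ : Fin 4, Integrable (fun y => (ca * ∑ k : Fin 3,
      p1CellVals (fun n k => p1DispSite a h U b₀ A n k) i m₁ k * p1CellVals (fun n k => p1DispSite a h U b₀ A n k) i m₂ k) *
        (fpFluxProfile S1 S2 3 (y - y₀) * (p1Lam a h i m₁ y * p1Lam a h i m₂ y))) (volume.restrict (p1RealCell a h i)) :=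
    fun m₁ m₂ => (integrableOn_fluxA₀ ha hh hS1 hS12 y₀ i m₁ m₂).const_mul _
  have hIB : ∀ (m₁ m₂ : Fin 4) (j l : Fin 3), Integrable (fun y => ((cb + cc) *
      (p1CellVals (fun n k => p1DispSite a h U b₀ A n k) i m₁ j * p1CellVals (fun n k => p1DispSite a h U b₀ A n k) i m₂ l)) *
        (fpFluxProfile S1 S2 4 (y - y₀) * (p1Lam a h i m₁ y * p1Lam a h i m₂ y * ((y - y₀) j * (y - y₀) l)))) (volume.restrict (p1RealCell a h i)) :=
    fun m₁ m₂ j l => (integrableOn_fluxB₀ ha hh hS1 hS12 y₀ i m₁ m₂ j l).const_mul _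
  have hIC : ∀ (m : Fin 4) (j : Fin 3), Integrable (fun y => (cn *
      ((∑ k : Fin 3, p1CellVals (fun n k => p1DispSite a h U b₀ A n k) i m k * (p1CellGrad a h U i k j - A k j)) -
        fpTr (fun j k => p1CellGrad a h U i j k - A j k) * p1CellVals (fun n k => p1DispSite a h U b₀ A n k) i m j)) *
        (fpFluxProfile S1 S2 3 (y - y₀) * (p1Lam a h i m y * (y - y₀) j))) (volume.restrict (p1RealCell a h i)) :=
    fun m j => (integrableOn_fluxC₀ ha hh hS1 hS12 y₀ i m j).const_mul _
  have hSA : Integrable (fun y => ∑ m₁ : Fin 4, ∑ m₂ : Fin 4, (ca * ∑ k : Fin 3,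
      p1CellVals (fun n k => p1DispSite a h U b₀ A n k) i m₁ k * p1CellVals (fun n k => p1DispSite a h U b₀ A n k) i m₂ k) *
        (fpFluxProfile S1 S2 3 (y - y₀) * (p1Lam a h i m₁ y * p1Lam a h i m₂ y))) (volume.restrict (p1RealCell a h i)) :=
    integrable_finsetSum _ fun m₁ _ => integrable_finsetSum _ fun m₂ _ => hIA m₁ m₂
  have hSB : Integrable (fun y => ∑ m₁ : Fin 4, ∑ m₂ : Fin 4, ∑ j : Fin 3, ∑ l : Fin 3, ((cb + cc) *
      (p1CellVals (fun n k => p1DispSite a h U b₀ A n k) i m₁ j * p1CellVals (fun n k => p1DispSite a h U b₀ A n k) i m₂ l)) *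
        (fpFluxProfile S1 S2 4 (y - y₀) * (p1Lam a h i m₁ y * p1Lam a h i m₂ y * ((y - y₀) j * (y - y₀) l)))) (volume.restrict (p1RealCell a h i)) :=
    integrable_finsetSum _ fun m₁ _ => integrable_finsetSum _ fun m₂ _ =>
      integrable_finsetSum _ fun j _ => integrable_finsetSum _ fun l _ => hIB m₁ m₂ j l
  have hSC : Integrable (fun y => ∑ m : Fin 4, ∑ j : Fin 3, (cn *
      ((∑ k : Fin 3, p1CellVals (fun n k => p1DispSite a h U b₀ A n k) i m k * (p1CellGrad a h U i k j - A k j)) -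
        fpTr (fun j k => p1CellGrad a h U i j k - A j k) * p1CellVals (fun n k => p1DispSite a h U b₀ A n k) i m j)) *
        (fpFluxProfile S1 S2 3 (y - y₀) * (p1Lam a h i m y * (y - y₀) j))) (volume.restrict (p1RealCell a h i)) :=
    integrable_finsetSum _ fun m _ => integrable_finsetSum _ fun j _ => hIC m j
  have hSAB : Integrable (fun y => (∑ m₁ : Fin 4, ∑ m₂ : Fin 4, (ca * ∑ k : Fin 3,
      p1CellVals (fun n k => p1DispSite a h U b₀ A n k) i m₁ k * p1CellVals (fun n k => p1DispSite a h U b₀ A n k) i m₂ k) *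
        (fpFluxProfile S1 S2 3 (y - y₀) * (p1Lam a h i m₁ y * p1Lam a h i m₂ y))) +
      ∑ m₁ : Fin 4, ∑ m₂ : Fin 4, ∑ j : Fin 3, ∑ l : Fin 3, ((cb + cc) *
      (p1CellVals (fun n k => p1DispSite a h U b₀ A n k) i m₁ j * p1CellVals (fun n k => p1DispSite a h U b₀ A n k) i m₂ l)) *
        (fpFluxProfile S1 S2 4 (y - y₀) * (p1Lam a h i m₁ y * p1Lam a h i m₂ y * ((y - y₀) j * (y - y₀) l)))) (volume.restrict (p1RealCell a h i)) :=
    hSA.add hSB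
  rw [integral_add hSAB hSC, integral_add hSA hSB]
  unfold p1FluxCellForm₀ p1FluxA₀ p1FluxB₀ p1FluxC₀
  congr 1
  congr 1
  · rw [integral_finsetSum _ fun m₁ _ => integrable_finsetSum _ fun m₂ _ => hIA m₁ m₂]
    refine Finset.sum_congr rfl fun m₁ _ => ?_
    rw [integral_finsetSum _ fun m₂ _ => hIA m₁ m₂]
    refine Finset.sum_congr rfl fun m₂ _ => ?_
    rw [integral_const_mul]
  · rw [integral_finsetSum _ fun m₁ _ => integrable_finsetSum _ fun m₂ _ =>
      integrable_finsetSum _ fun j _ => integrable_finsetSum _ fun l _ => hIB m₁ m₂ j l]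
    refine Finset.sum_congr rfl fun m₁ _ => ?_
    rw [integral_finsetSum _ fun m₂ _ => integrable_finsetSum _ fun j _ => integrable_finsetSum _ fun l _ => hIB m₁ m₂ j l]
    refine Finset.sum_congr rfl fun m₂ _ => ?_
    rw [integral_finsetSum _ fun j _ => integrable_finsetSum _ fun l _ => hIB m₁ m₂ j l]
    refine Finset.sum_congr rfl fun j _ => ?_
    rw [integral_finsetSum _ fun l _ => hIB m₁ m₂ j l]
    refine Finset.sum_congr rfl fun l _ => ?_
    rw [integral_const_mul]
  · rw [integral_finsetSum _ fun m _ => integrable_finsetSum _ fun j _ => hIC m j]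
    refine Finset.sum_congr rfl fun m _ => ?_
    rw [integral_finsetSum _ fun j _ => hIC m j]
    refine Finset.sum_congr rfl fun j _ => ?_
    rw [integral_const_mul]

end cell

/-! ## The global identity for the translated field -/

/-- **FLUX IDENTIFICATION RE-BASED AT `y₀`.**  For `0 < a, h`, `0 < S₁ < S₂`, any finitely supported `U`, any `(b₀, A)`, any flux vector and ANY base point `y₀`,
the boundary term of the far theorem for the translated far-ledger field `x ↦ p1Disp a h U b₀ A (y₀ + x)` equals the cellwise sum of the re-centred cell flux forms of
the vertex values and element gradients: `∫ 2χ⟪∇χ, Φ(ṽ)⟫ = Σ'_T p1FluxCellForm₀(y₀)(T)(W_T, G_T − A)`.  NOT a proof of H12⋆, NOT summit progress. -/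
theorem integral_flux_p1Disp_translate_eq_tsum {a h S1 S2 : ℝ} (ha : 0 < a) (hh : 0 < h) (hS1 : 0 < S1) (hS12 : S1 < S2)
    (ca cb cc cn : ℝ) (U : ℤ × ℤ × ℤ → (Fin 3 → ℝ)) (hU : (support U).Finite) (b₀ : Fin 3 → ℝ) (A : Fin 3 → Fin 3 → ℝ) (y₀ : Fin 3 → ℝ) :
    ∫ x, 2 * fpChi S1 S2 x * fpFlux4DotGrad ca cb cc cn (fun y => p1Disp a h U b₀ A (y₀ + y)) (fpChi S1 S2) x =
      ∑' i, p1FluxCellForm₀ S1 S2 ca cb cc cn a h y₀ i (p1CellVals (fun n k => p1DispSite a h U b₀ A n k) i)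
        (fun j k => p1CellGrad a h U i j k - A j k) := by
  have ha' := ha.ne'
  have hh' := hh.ne'
  set v := p1Disp a h U b₀ A with hvdef
  -- the integrand is the translate of H(y) = pre(y − y₀)·D(y − y₀, v y, ∇v y)
  set H : (Fin 3 → ℝ) → ℝ := fun y => fpFluxPre S1 S2 (y - y₀) * fpFluxDensity ca cb cc cn (y - y₀) (v y) (fpGrad v y) with hHdef
  have hpt : ∀ x, 2 * fpChi S1 S2 x * fpFlux4DotGrad ca cb cc cn (fun y => v (y₀ + y)) (fpChi S1 S2) x = H (y₀ + x) := by
    intro x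
    rw [two_chi_fpFlux4DotGrad_eq_density, fpGrad_comp_add_left, hHdef]
    simp only [add_sub_cancel_left]
  -- integrability of the translated integrand, hence of H
  obtain ⟨K, hK⟩ := exists_lipschitzWith_p1Disp ha' hh' U hU b₀ A
  have hF : Integrable fun x => 2 * fpChi S1 S2 x * fpFlux4DotGrad ca cb cc cn (fun y => v (y₀ + y)) (fpChi S1 S2) x :=
    integrable_flux_of_lipschitz hS1 hS12 ca cb cc cn (lipschitzWith_translate hK y₀)
      ((continuous_p1Disp a h U b₀ A).comp (continuous_const.add continuous_id))
  have hH : Integrable H := by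
    have h1 := hF.comp_add_left (-y₀)
    refine h1.congr (Eventually.of_forall fun y => ?_)
    simp only [hpt, add_neg_cancel_left]
  -- translation invariance and the cells decomposition
  have hrw : (fun x => 2 * fpChi S1 S2 x * fpFlux4DotGrad ca cb cc cn (fun y => v (y₀ + y)) (fpChi S1 S2) x) = fun x => H (y₀ + x) :=
    funext hpt
  rw [hrw, integral_add_left_eq_self H y₀, integral_eq_tsum_p1RealCell ha' hh' hH]
  exact tsum_congr fun i => setIntegral_fluxTranslate_p1RealCell ha hh hS1 hS12 y₀ i ca cb cc cn U b₀ A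

/-- **Instance F2, re-based** (the certificate of the matched split, odd representative / any site). NOT a proof of H12⋆, NOT summit progress. -/
theorem integral_fluxF2_p1Disp_translate_eq_tsum {a h : ℝ} (ha : 0 < a) (hh : 0 < h) (U : ℤ × ℤ × ℤ → (Fin 3 → ℝ))
    (hU : (support U).Finite) (b₀ : Fin 3 → ℝ) (A : Fin 3 → Fin 3 → ℝ) (y₀ : Fin 3 → ℝ) {R1 R2 : ℝ} (hR1 : 0 < R1) (hR12 : R1 < R2) :
    ∫ x, 2 * fpChi (R1 ^ 2) (R2 ^ 2) x *
        fpFlux4DotGrad (1 / 3) (4 / 3) (-9 / 8) (1 / 8) (fun y => p1Disp a h U b₀ A (y₀ + y)) (fpChi (R1 ^ 2) (R2 ^ 2)) x =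
      ∑' i, p1FluxCellForm₀ (R1 ^ 2) (R2 ^ 2) (1 / 3) (4 / 3) (-9 / 8) (1 / 8) a h y₀ i
        (p1CellVals (fun n k => p1DispSite a h U b₀ A n k) i) (fun j k => p1CellGrad a h U i j k - A j k) :=
  integral_flux_p1Disp_translate_eq_tsum ha hh (pow_pos hR1 2) (pow_lt_pow_left₀ hR12 hR1.le two_ne_zero) _ _ _ _ U hU b₀ A y₀

/-! ## Vertex-value form -/

/-- **The re-centred cell flux form as a pure quadratic form of the twelve vertex values** (element gradient eliminated through `∂λ_m`). -/
def p1FluxQuad₀ (S1 S2 ca cb cc cn a h : ℝ) (y₀ : Fin 3 → ℝ) (i : (ℤ × ℤ × ℤ) × Fin 6) (W : Fin 4 → Fin 3 → ℝ) : ℝ :=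
  p1FluxCellForm₀ S1 S2 ca cb cc cn a h y₀ i W (fun j k => ∑ m : Fin 4, p1LamGrad a h i m j * W m k)

/-- **FLUX IDENTIFICATION RE-BASED AT `y₀`, vertex-value form**: `∫ 2χ⟪∇χ, Φ(ṽ)⟫ = Σ'_T p1FluxQuad₀(y₀)(T)(W_T)`.  NOT a proof of H12⋆, NOT summit progress. -/
theorem integral_flux_p1Disp_translate_eq_tsum_quad {a h S1 S2 : ℝ} (ha : 0 < a) (hh : 0 < h) (hS1 : 0 < S1) (hS12 : S1 < S2)
    (ca cb cc cn : ℝ) (U : ℤ × ℤ × ℤ → (Fin 3 → ℝ)) (hU : (support U).Finite) (b₀ : Fin 3 → ℝ) (A : Fin 3 → Fin 3 → ℝ) (y₀ : Fin 3 → ℝ) :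
    ∫ x, 2 * fpChi S1 S2 x * fpFlux4DotGrad ca cb cc cn (fun y => p1Disp a h U b₀ A (y₀ + y)) (fpChi S1 S2) x =
      ∑' i, p1FluxQuad₀ S1 S2 ca cb cc cn a h y₀ i (p1CellVals (fun n k => p1DispSite a h U b₀ A n k) i) := by
  rw [integral_flux_p1Disp_translate_eq_tsum ha hh hS1 hS12 ca cb cc cn U hU b₀ A y₀]
  refine tsum_congr fun i => ?_
  rw [p1FluxQuad₀, ← p1CellGrad_sub_eq_sum_p1LamGrad ha hh U b₀ A i]

end Summit.AtomisticToContinuum.Crystallization.Theorems.StrictSplittingRuleBirth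

end
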